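import Summits.Ventures.QEC.CircuitDistance.ETowerNodesZ
import Summits.Ventures.QEC.CircuitDistance.ETowerTopsZ
import Summits.Ventures.QEC.CircuitDistance.ETowerCountZ
import Summits.Ventures.QEC.CircuitDistance.ETowerBase
import Summits.Ventures.QEC.CircuitDistance.PortK2InstBB144Final
import HarnessLib

/-!
# P3-PORT STEP 2 (E-fold tower), sector Z: THE ASSEMBLY — from the unit / window / base-slice / zero-fibre facts to
# `K2_BB144_Z` by plain `decide` (ASSEMBLY-SPEC §C; cell `qec`, experiment CDX, seat qec-cdx-type-1)

`k2_bb144_Z_of_tower`: the K2 list-completeness binder of record `K2_BB144_Z` (PortBB144Value) from FOUR data inputs, each a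
conjunction of `decide +kernel` facts emitted by eng-1 / idea-1 (no cube runs, no `native_decide`):
(U) units — `nodeA (bitsOf 45 0 t) = true` for every base numeral `t ∈ T3`;  (W) windows — `nodeCW L w = true` for the 4 × 8
weight-3 words/windows;  (B) base slices — `sliceCheck col3 3 3 5 9 T3 = true`, `Fibre.incr T3 = true`, orbit-size sums
`osum 3 3 5 w T3 = NW[w]` (w = 1..9);  (Z) zero fibres — the step-A zero-fibre property (from D-lists via `goodFibK_zero`,
§B10).  Composition: `hW3_of_winsZ` → `hkAZ` (units as fibre properties) → `base_of_slices` + `card_Xw_Z` → ★ `kc_of_tower` →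
`binder_of_kc` (with `goodZ144`, `hlogZ144`, `hTOPS`, `hidx`) → the classes step of `k2_bb144_Z`.
Nothing here asserts a value of `d_circ`; with the [[144]] X twin and `bb144_circuitDistance_eq_ten` it yields the std word.
-/

set_option maxRecDepth 100000
set_option exponentiation.threshold 1024

namespace Summit.Ventures.QEC.CircuitDistance.ETower.SecZ

open Literature.InformationTheory.QuantumCodes Summit.Ventures.QEC.Census Summit.Ventures.QEC.Census.Fold
  Summit.Ventures.QEC.CircuitDistance.ETower Finset K2

/-- The KERNEL-COMPLETENESS statement of sector Z: every kernel word of the record's syndrome table of weight `≤ 9` has all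
logical parities zero or is a translate of a listed anchored class. -/
def KC : Prop := ∀ u, u < 2 ^ nK GC 5 → kerK col0 (nK GC 5) u → popc (nK GC 5) u ≤ 9 → QT u

/-- ★ **THE TOWER GIVES `KC`** from the four data inputs. -/
theorem kcZ_of_data {T3 : List ℕ}
    (hU : ∀ t ∈ T3, nodeA (bitsOf 45 0 t) = true)
    (hW : ∀ L ∈ W3L, ∀ w ∈ W3WIN3, nodeCW L w = true)
    (hBcheck : sliceCheck col3 3 3 5 9 T3 = true) (hBincr : Fibre.incr T3 = true)
    (hBsum : ∀ w, 1 ≤ w → w ≤ 9 → osum 3 3 5 w T3 = NW.getD w 0)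
    (hZ : GoodFibK GA 5 col2 9 NB 0) : KC := by
  have hW3 : ∀ r ∈ W3C, NC r := hW3_of_winsZ hW
  -- units as fibre properties at the base numerals
  have hunits : ∀ t ∈ T3, GoodFibK GA 5 col2 9 NB t := by
    intro t ht
    have hlt : t < 2 ^ (5 * (3 * 3)) := (of_sliceCheck hBcheck t ht).1
    have h := hkAZ hW3 (bitsOf 45 0 t) (fun j hj => lt_of_lt_of_eq (lt_of_mem_bitsOf hj) (by decide)) (hU t ht)
    rwa [maskOf_bitsOf_zero _ _ hlt] at h
  -- base certificate
  have hbase : ∀ s, s < 2 ^ nsK GA 5 → kerK col3 (nsK GA 5) s → popc (nsK GA 5) s ≤ 9 → s = 0 ∨ MatchedK GA.ls GA.ms 5 T3 s := by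
    have e : nsK GA 5 = 5 * (3 * 3) := by decide
    rw [e]
    exact base_of_slices (ls := 3) (ms := 3) (by decide) (by decide) hK3 T3 hBcheck hBincr
      (fun w h1 hw => by rw [hBsum w h1 hw]; exact (card_Xw_Z hw).symm)
  -- the composed tower
  exact kc_of_tower shapeA shapeB shapeC okA okB okC ⟨by decide, by decide⟩ ⟨by decide, by decide⟩ hRA hRB hRC hK2 hK1 hK0
    hQTZ hbase hunits hZ

/-- ★ **`K2_BB144_Z` FROM THE TOWER** (same statement as the binder of record; replaces the cube runs of `k2_bb144_Z`). -/
theorem k2_bb144_Z_of_kc (hKC : KC) : K2_BB144_Z := by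
  intro x hcls hnt hcard
  have hall := classesZ144OK_true
  unfold classesZ144OK at hall
  simp only [List.all_eq_true] at hall
  have hx : ∀ g ∈ x, g ∈ instZ144.gsupp := by
    intro g hg
    obtain ⟨k, hk, i, hi⟩ := hcls g hg
    have h := hall k hk i (mem_monoList i)
    cases hck : bb144ZTable.cls k with
    | none => rw [hck] at hi; exact absurd hi (by simp)
    | some g₀ =>
      rw [hck] at hi h
      simp only [Option.map_some, Option.some.injEq] at hi
      simp only [decide_eq_true_eq] at h
      rw [← hi]; exact h
  obtain ⟨wd, hwd, t, hxt⟩ := binder_of_kc (I := instZ144) goodZ144 hlogZ144 (by decide) (by decide) (nb := 5) (W := 9)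
    (TOPS := TOPS) rfl (fun u hu hk hw => hKC u hu hk hw) hTOPS hidx x hx hnt.1 hnt.2 hcard
  obtain ⟨e, he, rfl⟩ := List.mem_map.1 hwd
  exact ⟨e, he, t, hxt⟩

/-- ★★ **`K2_BB144_Z` from the four data inputs** (units, windows, base slices, step-A zero fibre). -/
theorem k2_bb144_Z_of_data {T3 : List ℕ}
    (hU : ∀ t ∈ T3, nodeA (bitsOf 45 0 t) = true)
    (hW : ∀ L ∈ W3L, ∀ w ∈ W3WIN3, nodeCW L w = true)
    (hBcheck : sliceCheck col3 3 3 5 9 T3 = true) (hBincr : Fibre.incr T3 = true)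
    (hBsum : ∀ w, 1 ≤ w → w ≤ 9 → osum 3 3 5 w T3 = NW.getD w 0)
    (hZ : GoodFibK GA 5 col2 9 NB 0) : K2_BB144_Z :=
  k2_bb144_Z_of_kc (kcZ_of_data hU hW hBcheck hBincr hBsum hZ)

end Summit.Ventures.QEC.CircuitDistance.ETower.SecZ
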